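import Literature.Probability.Percolation.TrapFencedExit
import Literature.Probability.Percolation.ArmSeparationExtFourAdj
import HarnessLib

/-!
# Two fenced exits of one colour with disjoint corridors land as `extOpenDuoQ`

Topic `Literature/Probability/Percolation`; family `crit-perc` / near-critical percolation on `𝕋`.
A brick of the near-critical arm-separation theorem for four arms in the ADJACENT colour
arrangement (P. Nolin, EJP 13 (2008), Thm. 11, `j = 4`, `σ = BBWW` [arXiv 0711.4948: Thm. 10];
the input `hsepAdj` of `Werner2009_lemma63_of_altSeparation_of_adjSeparation`), landing step.

The deterministic core of the landing of the two arms of one colour: two fenced exits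
(`TrapFencedExit`, read through rotations `ρ^{i₀}`, `ρ^{i₁}`) with routes `S₀`, `S₁`, the corridor
of the first (spoke, ring arc, approach, thinned target) aimed at the RIGHT side of `∂Λ_{4M}` and
that of the second at the TOP side, all crossed, and the two REGIONS (route, corner box, spoke box,
arc boxes, approach and target strips — `rowRegion`, `twoRegion`) DISJOINT. Then the configuration
restricted to each region still carries the exit and its corridor (`TrapFencedExit.restrictTo`,
`triHCross_inter`, `Tube.event_inter`, …), the two landing moves `rot_exit_landing_move_row/_two`
apply to the restrictions, and `ω ∈ extOpenDuoQ n (4M)` (`extOpenDuoQ_of_exits`). The probabilistic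
step (generalised FKG over slots) and the construction of the exits from the pair step are elsewhere.

Everything here is proved; no named facts are introduced.

## References

* P. Nolin, Near-critical percolation in two dimensions, *Electron. J. Probab.* 13 (2008), §4.3
  Prop. 12, §4.4 (arXiv 0711.4948: Prop. 11; proof of Thm. 10, pp. 12–13) [Nolin2008].
* H. Kesten, Scaling relations for 2D-percolation, *Comm. Math. Phys.* 109 (1987), Lemma 4 [Kesten1987].
-/

noncomputable section

open Set

namespace Literature.Probability.Percolation

open LatticeModels Tube

/-! ### Restricting configurations -/

/-- A horizontal crossing survives restriction to a set containing the strip. [folklore] -/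
theorem triHCross_inter {a b : ℤ} {m k : ℕ} {ω : SiteConfig (Site 2)} {X : Set (Site 2)}
    (h : ω ∈ triHCross a b m k) (hX : triStrip a b m k ⊆ X) : ω ∩ X ∈ triHCross a b m k := by
  obtain ⟨x, y, hx, hy, P⟩ := h
  exact ⟨x, y, hx, hy, P.mono fun v hv => ⟨hv.1, hv.2, hX hv.1⟩⟩

/-- A vertical crossing survives restriction to a set containing the strip. [folklore] -/
theorem triVCross_inter {a b : ℤ} {m k : ℕ} {ω : SiteConfig (Site 2)} {X : Set (Site 2)}
    (h : ω ∈ triVCross a b m k) (hX : triStrip a b m k ⊆ X) : ω ∩ X ∈ triVCross a b m k := by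
  obtain ⟨x, y, hx, hy, P⟩ := h
  exact ⟨x, y, hx, hy, P.mono fun v hv => ⟨hv.1, hv.2, hX hv.1⟩⟩

/-- The box of a tube is its strip. [folklore] -/
theorem Tube.box_eq_triStrip (T : Tube) : T.box = triStrip T.a T.b T.w T.h := by
  ext v; rw [Tube.mem_box, mem_triStrip]

/-- A tube crossing survives restriction to a set containing the box. [folklore] -/
theorem Tube.event_inter {T : Tube} {ω : SiteConfig (Site 2)} {X : Set (Site 2)} (h : ω ∈ T.event) (hX : T.box ⊆ X) :
    ω ∩ X ∈ T.event := by
  rw [Tube.box_eq_triStrip] at hX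
  unfold Tube.event at h ⊢
  cases hT : T.horiz
  · rw [hT] at h; simp only [cond_false] at h ⊢; exact triVCross_inter h hX
  · rw [hT] at h; simp only [cond_true] at h ⊢; exact triHCross_inter h hX

/-- All crossings of a list survive restriction to a set containing all boxes. [folklore] -/
theorem eventAll_inter {L : List Tube} {ω : SiteConfig (Site 2)} {X : Set (Site 2)} (h : ω ∈ eventAll L) (hX : boxAll L ⊆ X) :
    ω ∩ X ∈ eventAll L := fun T hT => Tube.event_inter (h T hT) fun _ hv => hX ⟨T, hT, hv⟩

/-- Rotated reading of a restricted configuration. [folklore] -/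
theorem rotConfig_inter (i : ℕ) (ω : SiteConfig (Site 2)) (X : Set (Site 2)) :
    rotConfig i (ω ∩ X) = rotConfig i ω ∩ (triRotIsoPow i) ⁻¹' X := by
  ext v; simp only [mem_rotConfig, Set.mem_inter_iff, Set.mem_preimage]

/-- The target space survives restriction. [folklore] -/
theorem otgtV_inter {N' : ℕ} {t : ℤ} {ω : SiteConfig (Site 2)} {X : Set (Site 2)} (h : ω ∈ otgtV N' t)
    (hX : triStrip ((N' : ℤ) + 1) (t - (N' / 64 : ℕ)) (N' / 16 - 1) (2 * (N' / 64)) ⊆ X) : ω ∩ X ∈ otgtV N' t :=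
  triVCross_inter h hX

namespace TrapFencedExit

variable {M n k₀ K : ℕ} {χ : SiteConfig (Site 2)}

/-- **Transfer to another configuration** containing the route and the open sites of the corner
box: a fenced exit of `χ'`. [folklore] -/
def restrictTo (F : TrapFencedExit M n k₀ K χ) (χ' : SiteConfig (Site 2)) {S : Set (Site 2)} (hP : PathIn triGraph S F.a F.m)
    (hS : S ⊆ (triAnnSet n (2 * M) ∪ trapFrameZone M F.z F.k) ∩ χ')
    (hbox : triStrip (F.z 0 + F.k) (F.z 1 + F.k) F.k F.k ∩ χ ⊆ χ') : TrapFencedExit M n k₀ K χ' where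
  z := F.z
  j := F.j
  m := F.m
  a := F.a
  z_mem := F.z_mem
  j_lt := F.j_lt
  norm_a := F.norm_a
  vcross := by
    obtain ⟨b, t, hb, ht, Pb, Pt⟩ := F.vcross
    exact ⟨b, t, hb, ht, Pb.mono fun v hv => ⟨hv.1, hbox hv⟩, Pt.mono fun v hv => ⟨hv.1, hbox hv⟩⟩
  path := hP.mono hS

end TrapFencedExit

namespace TrapExit

variable {M n k₀ K : ℕ} {χ : SiteConfig (Site 2)}

/-- **Transfer of an exit to another configuration** containing the route and the open sites of the
corner box. [folklore] -/
def restrictTo (F : TrapExit M n k₀ K χ) (χ' : SiteConfig (Site 2)) {S : Set (Site 2)} (hP : PathIn triGraph S F.a F.m)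
    (hS : S ⊆ (triAnnSet n (2 * M) ∪ trapExitZone M F.z F.k) ∩ χ')
    (hbox : triStrip (F.z 0 + F.k) (F.z 1 + F.k) F.k F.k ∩ χ ⊆ χ') : TrapExit M n k₀ K χ' where
  z := F.z
  j := F.j
  m := F.m
  a := F.a
  z_mem := F.z_mem
  j_lt := F.j_lt
  norm_a := F.norm_a
  vcross := by
    obtain ⟨b, t, hb, ht, Pb, Pt⟩ := F.vcross
    exact ⟨b, t, hb, ht, Pb.mono fun v hv => ⟨hv.1, hbox hv⟩, Pt.mono fun v hv => ⟨hv.1, hbox hv⟩⟩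
  path := hP.mono hS

end TrapExit

/-! ### The regions -/

/-- **The region of an exit landing on the right side**: the `ρ^i`-images of the route, the corner
box and the spoke box, the boxes of the arc, the approach strip and the thinned target strip. [cite: Nolin2008, §4.3 Prop. 12 (proof) (arXiv 0711.4948: Prop. 11)] -/
def rowRegion (i M : ℕ) (S : Set (Site 2)) (z : Site 2) (k : ℕ) (T₀ : ℤ) (w L ε r e s a len : ℕ) (t : ℤ) (W : ℕ) : Set (Site 2) :=
  triRotIsoPow i '' (S ∪ triStrip (z 0 + k) (z 1 + k) k k ∪ (extSpokeTube M k T₀ w L ε).box) ∪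
    (boxAll (arc (thinRing r e s) a len) ∪ triStrip ((r : ℤ) - 2 * e) t W (4 * M / 64) ∪
      triStrip ((4 * M : ℕ) + 1) (t - (4 * M / 64 : ℕ)) (4 * M / 16 - 1) (2 * (4 * M / 64)))

/-- **The region of an exit landing on the top side**: as `rowRegion`, the approach and target strips
transposed. [cite: Nolin2008, §4.3 Prop. 12 (proof) (arXiv 0711.4948: Prop. 11)] -/
def twoRegion (i M : ℕ) (S : Set (Site 2)) (z : Site 2) (k : ℕ) (T₀ : ℤ) (w L ε r e s a len : ℕ) (t : ℤ) (W : ℕ) : Set (Site 2) :=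
  triRotIsoPow i '' (S ∪ triStrip (z 0 + k) (z 1 + k) k k ∪ (extSpokeTube M k T₀ w L ε).box) ∪
    (boxAll (arc (thinRing r e s) a len) ∪
      {v | frameIso 2 v ∈ triStrip ((r : ℤ) - 2 * e) t W (4 * M / 64) ∪
        triStrip ((4 * M : ℕ) + 1) (t - (4 * M / 64 : ℕ)) (4 * M / 16 - 1) (2 * (4 * M / 64))})

/-! ### One exit, restricted -/

/-- **The move of an exit to the right side, restricted to the region.** [cite: Nolin2008, §4.3 Prop. 12 and §4.4 (arXiv 0711.4948: Prop. 11, Thm. 10, p. 12)] -/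
theorem extOpenArm_inter_rowRegion' {M n k₀ K R₀ : ℕ} (hnM : n ≤ M) {i : ℕ} (hi : i < 6) {ω : SiteConfig (Site 2)}
    (F : TrapExit M n k₀ K (rotConfig i ω)) {S : Set (Site 2)} (hP : PathIn triGraph S F.a F.m)
    (hS : S ⊆ (triAnnSet n (2 * M) ∪ trapExitZone M F.z F.k) ∩ rotConfig i ω)
    (hmid : -(2 * (M : ℤ)) + R₀ ≤ F.z 1 ∧ F.z 1 ≤ -(R₀ : ℤ)) (hR : 4 * F.k + 2 ≤ R₀) (hkM : 2 * (F.k : ℤ) + 1 ≤ M)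
    {T₀ : ℤ} {w : ℕ} (hwin : T₀ ≤ F.z 1 ∧ F.z 1 < T₀ + w) (hT₀ : -(2 * (M : ℤ)) ≤ T₀)
    {L ε : ℕ} (hfit : (w : ℤ) + (F.k / 4 : ℕ) + 2 * ε ≤ F.k) (hL : F.k + 1 ≤ L) (hSp : ω ∈ extSpokeEvent i M F.k T₀ w L ε)
    {r e s a len : ℕ} (hs : 1 ≤ s) (hsr : s ∣ r) (hsr' : s ≤ r) (he : 2 * e ≤ r)
    (harc : ω ∈ eventAll (arc (thinRing r e s) a len))
    {Te : Tube} (hTe : Te ∈ arc (thinRing r e s) a len) (hJ : SpokeMeetsRot i (extSpokeTube M F.k T₀ w L ε) Te)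
    {t : ℤ} (ht : -(2 * (M : ℤ)) + (4 * M / 16 : ℕ) ≤ t ∧ t ≤ -(M : ℤ) - (4 * M / 16 : ℕ))
    {j₀ d : ℕ} (hSL : ∀ T ∈ vchunks r (-(r : ℤ)) e s j₀ (d + 1), T ∈ arc (thinRing r e s) a len)
    (hlo : -(r : ℤ) + j₀ * s - e ≤ t) (hhi : t + (4 * M / 64 : ℕ) ≤ -(r : ℤ) + (j₀ + d) * s - e)
    {W : ℕ} (hW : (r : ℤ) - 2 * e + W = 4 * M + (4 * M / 16 : ℕ))
    (hH : ω ∈ triHCross ((r : ℤ) - 2 * e) t W (4 * M / 64)) (hV : ω ∈ otgtV (4 * M) t)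
    (hM : 64 ≤ M) (hkL : (F.k : ℤ) + L ≤ 2 * M) (hr2 : 2 * (M : ℤ) < (r : ℤ) - s - 2 * e) (hr4 : (r : ℤ) + 2 * e ≤ 4 * M) :
    ω ∩ rowRegion i M S F.z F.k T₀ w L ε r e s a len t W ∈ extOpenArm n (4 * M) := by
  set X := rowRegion i M S F.z F.k T₀ w L ε r e s a len t W with hX
  have hSX : S ⊆ (triRotIsoPow i) ⁻¹' X := fun v hv => Or.inl ⟨v, Or.inl (Or.inl hv), rfl⟩
  have hBX : triStrip (F.z 0 + F.k) (F.z 1 + F.k) F.k F.k ⊆ (triRotIsoPow i) ⁻¹' X := fun v hv =>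
    Or.inl ⟨v, Or.inl (Or.inr hv), rfl⟩
  have hSpX : (extSpokeTube M F.k T₀ w L ε).box ⊆ (triRotIsoPow i) ⁻¹' X := fun v hv => Or.inl ⟨v, Or.inr hv, rfl⟩
  -- the exit of the restricted configuration
  set F' : TrapExit M n k₀ K (rotConfig i (ω ∩ X)) :=
    F.restrictTo (rotConfig i (ω ∩ X)) hP
      (fun v hv => ⟨(hS hv).1, by rw [rotConfig_inter]; exact ⟨(hS hv).2, hSX hv⟩⟩)
      (fun v hv => by rw [rotConfig_inter]; exact ⟨hv.2, hBX hv.1⟩) with hF'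
  have hz : F'.z = F.z := rfl
  have hk : F'.k = F.k := rfl
  have ha : F'.a = F.a := rfl
  -- the events of the restricted configuration
  have hSp' : ω ∩ X ∈ extSpokeEvent i M F.k T₀ w L ε := by
    show rotConfig i (ω ∩ X) ∈ (extSpokeTube M F.k T₀ w L ε).event
    rw [rotConfig_inter]
    exact Tube.event_inter hSp hSpX
  have harc' : ω ∩ X ∈ eventAll (arc (thinRing r e s) a len) :=
    eventAll_inter harc fun v hv => Or.inr (Or.inl (Or.inl hv))
  have hH' : ω ∩ X ∈ triHCross ((r : ℤ) - 2 * e) t W (4 * M / 64) := triHCross_inter hH fun v hv => Or.inr (Or.inl (Or.inr hv))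
  have hV' : ω ∩ X ∈ otgtV (4 * M) t := otgtV_inter hV fun v hv => Or.inr (Or.inr hv)
  exact rot_exit_landing_move_row' hnM hi F' (by rw [hz]; exact hmid) (by rw [hk]; exact hR) (by rw [hk]; exact hkM)
    (by rw [hz]; exact hwin) hT₀ (by rw [hk]; exact hfit) (by rw [hk]; exact hL) hSp' hs hsr hsr' he harc' hTe
    (by rw [hk]; exact hJ) ht hSL hlo hhi hW hH' hV' hM (by rw [hk]; exact hkL) hr2 hr4

/-- **The move of a fenced exit to the right side, restricted to the region** (through `toTrapExit`). [cite: Nolin2008, §4.3 Prop. 12 and §4.4 (arXiv 0711.4948: Prop. 11, Thm. 10, p. 12)] -/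
theorem extOpenArm_inter_rowRegion {M n k₀ K R₀ : ℕ} (hnM : n ≤ M) {i : ℕ} (hi : i < 6) {ω : SiteConfig (Site 2)}
    (F : TrapFencedExit M n k₀ K (rotConfig i ω)) {S : Set (Site 2)} (hP : PathIn triGraph S F.a F.m)
    (hS : S ⊆ (triAnnSet n (2 * M) ∪ trapFrameZone M F.z F.k) ∩ rotConfig i ω)
    (hmid : -(2 * (M : ℤ)) + R₀ ≤ F.z 1 ∧ F.z 1 ≤ -(R₀ : ℤ)) (hR : 4 * F.k + 2 ≤ R₀) (hkM : 2 * (F.k : ℤ) + 1 ≤ M)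
    {T₀ : ℤ} {w : ℕ} (hwin : T₀ ≤ F.z 1 ∧ F.z 1 < T₀ + w) (hT₀ : -(2 * (M : ℤ)) ≤ T₀)
    {L ε : ℕ} (hfit : (w : ℤ) + (F.k / 4 : ℕ) + 2 * ε ≤ F.k) (hL : F.k + 1 ≤ L) (hSp : ω ∈ extSpokeEvent i M F.k T₀ w L ε)
    {r e s a len : ℕ} (hs : 1 ≤ s) (hsr : s ∣ r) (hsr' : s ≤ r) (he : 2 * e ≤ r)
    (harc : ω ∈ eventAll (arc (thinRing r e s) a len))
    {Te : Tube} (hTe : Te ∈ arc (thinRing r e s) a len) (hJ : SpokeMeetsRot i (extSpokeTube M F.k T₀ w L ε) Te)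
    {t : ℤ} (ht : -(2 * (M : ℤ)) + (4 * M / 16 : ℕ) ≤ t ∧ t ≤ -(M : ℤ) - (4 * M / 16 : ℕ))
    {j₀ d : ℕ} (hSL : ∀ T ∈ vchunks r (-(r : ℤ)) e s j₀ (d + 1), T ∈ arc (thinRing r e s) a len)
    (hlo : -(r : ℤ) + j₀ * s - e ≤ t) (hhi : t + (4 * M / 64 : ℕ) ≤ -(r : ℤ) + (j₀ + d) * s - e)
    {W : ℕ} (hW : (r : ℤ) - 2 * e + W = 4 * M + (4 * M / 16 : ℕ))
    (hH : ω ∈ triHCross ((r : ℤ) - 2 * e) t W (4 * M / 64)) (hV : ω ∈ otgtV (4 * M) t)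
    (hM : 64 ≤ M) (hkL : (F.k : ℤ) + L ≤ 2 * M) (hr2 : 2 * (M : ℤ) < (r : ℤ) - s - 2 * e) (hr4 : (r : ℤ) + 2 * e ≤ 4 * M) :
    ω ∩ rowRegion i M S F.z F.k T₀ w L ε r e s a len t W ∈ extOpenArm n (4 * M) :=
  extOpenArm_inter_rowRegion' hnM hi F.toTrapExit hP (hS.trans exitRegion_mono) hmid hR hkM hwin hT₀ hfit hL hSp hs hsr hsr' he harc
    hTe hJ ht hSL hlo hhi hW hH hV hM hkL hr2 hr4

/-- **The move to the top side, restricted to the region.** [cite: Nolin2008, §4.3 Prop. 12 and §4.4 (arXiv 0711.4948: Prop. 11, Thm. 10, p. 12)] -/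
theorem extOpenArm_two_inter_twoRegion {M n k₀ K R₀ : ℕ} (hnM : n ≤ M) {i : ℕ} (hi : i < 6) {ω : SiteConfig (Site 2)}
    (F : TrapFencedExit M n k₀ K (rotConfig i ω)) {S : Set (Site 2)} (hP : PathIn triGraph S F.a F.m)
    (hS : S ⊆ (triAnnSet n (2 * M) ∪ trapFrameZone M F.z F.k) ∩ rotConfig i ω)
    (hmid : -(2 * (M : ℤ)) + R₀ ≤ F.z 1 ∧ F.z 1 ≤ -(R₀ : ℤ)) (hR : 4 * F.k + 2 ≤ R₀) (hkM : 2 * (F.k : ℤ) + 1 ≤ M)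
    {T₀ : ℤ} {w : ℕ} (hwin : T₀ ≤ F.z 1 ∧ F.z 1 < T₀ + w) (hT₀ : -(2 * (M : ℤ)) ≤ T₀)
    {L ε : ℕ} (hfit : (w : ℤ) + (F.k / 4 : ℕ) + 2 * ε ≤ F.k) (hL : F.k + 1 ≤ L) (hSp : ω ∈ extSpokeEvent i M F.k T₀ w L ε)
    {r e s a len : ℕ} (hs : 1 ≤ s) (hsr : s ∣ r) (hsr' : s ≤ r) (he : 2 * e ≤ r)
    (harc : ω ∈ eventAll (arc (thinRing r e s) a len))
    {Te : Tube} (hTe : Te ∈ arc (thinRing r e s) a len) (hJ : SpokeMeetsRot i (extSpokeTube M F.k T₀ w L ε) Te)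
    {t : ℤ} (ht : -(2 * (M : ℤ)) + (4 * M / 16 : ℕ) ≤ t ∧ t ≤ -(M : ℤ) - (4 * M / 16 : ℕ))
    {j₀ d : ℕ} (hSL : ∀ T ∈ vchunks r (-(r : ℤ)) e s j₀ (d + 1), T.swap ∈ arc (thinRing r e s) a len)
    (hlo : -(r : ℤ) + j₀ * s - e ≤ t) (hhi : t + (4 * M / 64 : ℕ) ≤ -(r : ℤ) + (j₀ + d) * s - e)
    {W : ℕ} (hW : (r : ℤ) - 2 * e + W = 4 * M + (4 * M / 16 : ℕ))
    (hH : frameConfig 2 ω ∈ triHCross ((r : ℤ) - 2 * e) t W (4 * M / 64)) (hV : frameConfig 2 ω ∈ otgtV (4 * M) t)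
    (hM : 64 ≤ M) (hkL : (F.k : ℤ) + L ≤ 2 * M) (hr2 : 2 * (M : ℤ) < (r : ℤ) - s - 2 * e) (hr4 : (r : ℤ) + 2 * e ≤ 4 * M) :
    frameConfig 2 (ω ∩ twoRegion i M S F.z F.k T₀ w L ε r e s a len t W) ∈ extOpenArm n (4 * M) := by
  set X := twoRegion i M S F.z F.k T₀ w L ε r e s a len t W with hX
  have hSX : S ⊆ (triRotIsoPow i) ⁻¹' X := fun v hv => Or.inl ⟨v, Or.inl (Or.inl hv), rfl⟩
  have hBX : triStrip (F.z 0 + F.k) (F.z 1 + F.k) F.k F.k ⊆ (triRotIsoPow i) ⁻¹' X := fun v hv =>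
    Or.inl ⟨v, Or.inl (Or.inr hv), rfl⟩
  have hSpX : (extSpokeTube M F.k T₀ w L ε).box ⊆ (triRotIsoPow i) ⁻¹' X := fun v hv => Or.inl ⟨v, Or.inr hv, rfl⟩
  set F' : TrapFencedExit M n k₀ K (rotConfig i (ω ∩ X)) :=
    F.restrictTo (rotConfig i (ω ∩ X)) hP
      (fun v hv => ⟨(hS hv).1, by rw [rotConfig_inter]; exact ⟨(hS hv).2, hSX hv⟩⟩)
      (fun v hv => by rw [rotConfig_inter]; exact ⟨hv.2, hBX hv.1⟩) with hF'
  have hz : F'.z = F.z := rfl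
  have hk : F'.k = F.k := rfl
  have hSp' : ω ∩ X ∈ extSpokeEvent i M F.k T₀ w L ε := by
    show rotConfig i (ω ∩ X) ∈ (extSpokeTube M F.k T₀ w L ε).event
    rw [rotConfig_inter]
    exact Tube.event_inter hSp hSpX
  have harc' : ω ∩ X ∈ eventAll (arc (thinRing r e s) a len) :=
    eventAll_inter harc fun v hv => Or.inr (Or.inl hv)
  have h2 : frameConfig 2 (ω ∩ X) = frameConfig 2 ω ∩ {v | frameIso 2 v ∈ X} := frameConfig_inter 2 ω X
  have hH' : frameConfig 2 (ω ∩ X) ∈ triHCross ((r : ℤ) - 2 * e) t W (4 * M / 64) := by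
    rw [h2]
    exact triHCross_inter hH fun v hv => by
      refine Or.inr (Or.inr ?_)
      simp only [Set.mem_setOf_eq, frameIso_two_two']
      exact Or.inl hv
  have hV' : frameConfig 2 (ω ∩ X) ∈ otgtV (4 * M) t := by
    rw [h2]
    exact otgtV_inter hV fun v hv => by
      refine Or.inr (Or.inr ?_)
      simp only [Set.mem_setOf_eq, frameIso_two_two']
      exact Or.inr hv
  exact rot_exit_landing_move_two hnM hi F' (by rw [hz]; exact hmid) (by rw [hk]; exact hR) (by rw [hk]; exact hkM)
    (by rw [hz]; exact hwin) hT₀ (by rw [hk]; exact hfit) (by rw [hk]; exact hL) hSp' hs hsr hsr' he harc' hTe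
    (by rw [hk]; exact hJ) ht hSL hlo hhi hW hH' hV' hM (by rw [hk]; exact hkL) hr2 hr4

/-! ### Two exits -/

/-- **Two exits of one colour with disjoint regions land as `extOpenDuoQ n (4M)`.** [cite: Nolin2008, §4.2 Def. 6–8, §4.3 Prop. 12 and §4.4 (arXiv 0711.4948: Def. 6–8, Prop. 11; proof of Thm. 10, p. 13), σ = BBWW] -/
theorem extOpenDuoQ_of_exits {M n k₀ K R₀ : ℕ} (hnM : n ≤ M) (hM : 64 ≤ M) {ω : SiteConfig (Site 2)}
    -- the exit landing on the right side
    {i₀ : ℕ} (hi₀ : i₀ < 6) (F₀ : TrapFencedExit M n k₀ K (rotConfig i₀ ω)) {S₀ : Set (Site 2)} (hP₀ : PathIn triGraph S₀ F₀.a F₀.m)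
    (hS₀ : S₀ ⊆ (triAnnSet n (2 * M) ∪ trapFrameZone M F₀.z F₀.k) ∩ rotConfig i₀ ω)
    (hmid₀ : -(2 * (M : ℤ)) + R₀ ≤ F₀.z 1 ∧ F₀.z 1 ≤ -(R₀ : ℤ)) (hRk₀ : 4 * F₀.k + 2 ≤ R₀) (hkM₀ : 2 * (F₀.k : ℤ) + 1 ≤ M)
    {T₀ : ℤ} {w₀ : ℕ} (hwin₀ : T₀ ≤ F₀.z 1 ∧ F₀.z 1 < T₀ + w₀) (hT₀ : -(2 * (M : ℤ)) ≤ T₀)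
    {L₀ ε₀ : ℕ} (hfit₀ : (w₀ : ℤ) + (F₀.k / 4 : ℕ) + 2 * ε₀ ≤ F₀.k) (hL₀ : F₀.k + 1 ≤ L₀) (hSp₀ : ω ∈ extSpokeEvent i₀ M F₀.k T₀ w₀ L₀ ε₀)
    {r₀ e₀ s₀ a₀ len₀ : ℕ} (hs₀ : 1 ≤ s₀) (hsr₀ : s₀ ∣ r₀) (hsr₀' : s₀ ≤ r₀) (he₀ : 2 * e₀ ≤ r₀)
    (harc₀ : ω ∈ eventAll (arc (thinRing r₀ e₀ s₀) a₀ len₀))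
    {Te₀ : Tube} (hTe₀ : Te₀ ∈ arc (thinRing r₀ e₀ s₀) a₀ len₀) (hJ₀ : SpokeMeetsRot i₀ (extSpokeTube M F₀.k T₀ w₀ L₀ ε₀) Te₀)
    {t₀ : ℤ} (ht₀ : -(2 * (M : ℤ)) + (4 * M / 16 : ℕ) ≤ t₀ ∧ t₀ ≤ -(M : ℤ) - (4 * M / 16 : ℕ))
    {j₀ d₀ : ℕ} (hSL₀ : ∀ T ∈ vchunks r₀ (-(r₀ : ℤ)) e₀ s₀ j₀ (d₀ + 1), T ∈ arc (thinRing r₀ e₀ s₀) a₀ len₀)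
    (hlo₀ : -(r₀ : ℤ) + j₀ * s₀ - e₀ ≤ t₀) (hhi₀ : t₀ + (4 * M / 64 : ℕ) ≤ -(r₀ : ℤ) + (j₀ + d₀) * s₀ - e₀)
    {W₀ : ℕ} (hW₀ : (r₀ : ℤ) - 2 * e₀ + W₀ = 4 * M + (4 * M / 16 : ℕ))
    (hH₀ : ω ∈ triHCross ((r₀ : ℤ) - 2 * e₀) t₀ W₀ (4 * M / 64)) (hV₀ : ω ∈ otgtV (4 * M) t₀)
    (hkL₀ : (F₀.k : ℤ) + L₀ ≤ 2 * M) (hr2₀ : 2 * (M : ℤ) < (r₀ : ℤ) - s₀ - 2 * e₀) (hr4₀ : (r₀ : ℤ) + 2 * e₀ ≤ 4 * M)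
    -- the exit landing on the top side
    {i₁ : ℕ} (hi₁ : i₁ < 6) (F₁ : TrapFencedExit M n k₀ K (rotConfig i₁ ω)) {S₁ : Set (Site 2)} (hP₁ : PathIn triGraph S₁ F₁.a F₁.m)
    (hS₁ : S₁ ⊆ (triAnnSet n (2 * M) ∪ trapFrameZone M F₁.z F₁.k) ∩ rotConfig i₁ ω)
    (hmid₁ : -(2 * (M : ℤ)) + R₀ ≤ F₁.z 1 ∧ F₁.z 1 ≤ -(R₀ : ℤ)) (hRk₁ : 4 * F₁.k + 2 ≤ R₀) (hkM₁ : 2 * (F₁.k : ℤ) + 1 ≤ M)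
    {T₁ : ℤ} {w₁ : ℕ} (hwin₁ : T₁ ≤ F₁.z 1 ∧ F₁.z 1 < T₁ + w₁) (hT₁ : -(2 * (M : ℤ)) ≤ T₁)
    {L₁ ε₁ : ℕ} (hfit₁ : (w₁ : ℤ) + (F₁.k / 4 : ℕ) + 2 * ε₁ ≤ F₁.k) (hL₁ : F₁.k + 1 ≤ L₁) (hSp₁ : ω ∈ extSpokeEvent i₁ M F₁.k T₁ w₁ L₁ ε₁)
    {r₁ e₁ s₁ a₁ len₁ : ℕ} (hs₁ : 1 ≤ s₁) (hsr₁ : s₁ ∣ r₁) (hsr₁' : s₁ ≤ r₁) (he₁ : 2 * e₁ ≤ r₁)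
    (harc₁ : ω ∈ eventAll (arc (thinRing r₁ e₁ s₁) a₁ len₁))
    {Te₁ : Tube} (hTe₁ : Te₁ ∈ arc (thinRing r₁ e₁ s₁) a₁ len₁) (hJ₁ : SpokeMeetsRot i₁ (extSpokeTube M F₁.k T₁ w₁ L₁ ε₁) Te₁)
    {t₁ : ℤ} (ht₁ : -(2 * (M : ℤ)) + (4 * M / 16 : ℕ) ≤ t₁ ∧ t₁ ≤ -(M : ℤ) - (4 * M / 16 : ℕ))
    {j₁ d₁ : ℕ} (hSL₁ : ∀ T ∈ vchunks r₁ (-(r₁ : ℤ)) e₁ s₁ j₁ (d₁ + 1), T.swap ∈ arc (thinRing r₁ e₁ s₁) a₁ len₁)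
    (hlo₁ : -(r₁ : ℤ) + j₁ * s₁ - e₁ ≤ t₁) (hhi₁ : t₁ + (4 * M / 64 : ℕ) ≤ -(r₁ : ℤ) + (j₁ + d₁) * s₁ - e₁)
    {W₁ : ℕ} (hW₁ : (r₁ : ℤ) - 2 * e₁ + W₁ = 4 * M + (4 * M / 16 : ℕ))
    (hH₁ : frameConfig 2 ω ∈ triHCross ((r₁ : ℤ) - 2 * e₁) t₁ W₁ (4 * M / 64)) (hV₁ : frameConfig 2 ω ∈ otgtV (4 * M) t₁)
    (hkL₁ : (F₁.k : ℤ) + L₁ ≤ 2 * M) (hr2₁ : 2 * (M : ℤ) < (r₁ : ℤ) - s₁ - 2 * e₁) (hr4₁ : (r₁ : ℤ) + 2 * e₁ ≤ 4 * M)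
    -- the two regions are disjoint
    (hdisj : Disjoint (rowRegion i₀ M S₀ F₀.z F₀.k T₀ w₀ L₀ ε₀ r₀ e₀ s₀ a₀ len₀ t₀ W₀)
      (twoRegion i₁ M S₁ F₁.z F₁.k T₁ w₁ L₁ ε₁ r₁ e₁ s₁ a₁ len₁ t₁ W₁)) :
    ω ∈ extOpenDuoQ n (4 * M) :=
  ⟨_, _, hdisj,
    extOpenArm_inter_rowRegion hnM hi₀ F₀ hP₀ hS₀ hmid₀ hRk₀ hkM₀ hwin₀ hT₀ hfit₀ hL₀ hSp₀ hs₀ hsr₀ hsr₀' he₀ harc₀ hTe₀ hJ₀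
      ht₀ hSL₀ hlo₀ hhi₀ hW₀ hH₀ hV₀ hM hkL₀ hr2₀ hr4₀,
    extOpenArm_two_inter_twoRegion hnM hi₁ F₁ hP₁ hS₁ hmid₁ hRk₁ hkM₁ hwin₁ hT₁ hfit₁ hL₁ hSp₁ hs₁ hsr₁ hsr₁' he₁ harc₁ hTe₁ hJ₁
      ht₁ hSL₁ hlo₁ hhi₁ hW₁ hH₁ hV₁ hM hkL₁ hr2₁ hr4₁⟩

/-! ### Two exits landing on CONSECUTIVE sides, read through rotations only -/

/-- Reading a configuration restricted to the `ρ^i`-image of a set. [folklore] -/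
theorem rotConfig_inter_image (i : ℕ) (ω : SiteConfig (Site 2)) (R : Set (Site 2)) :
    rotConfig i (ω ∩ triRotIsoPow i '' R) = rotConfig i ω ∩ R := by
  rw [rotConfig_inter]
  congr 1
  ext v
  simp only [Set.mem_preimage, Set.mem_image]
  constructor
  · rintro ⟨u, hu, huv⟩
    rwa [← (triRotIsoPow i).injective huv]
  · exact fun hv => ⟨v, hv, rfl⟩

/-- Iterating a rotated reading: `rotConfig a (rotConfig b ω) = rotConfig (a + b) ω`. [folklore] -/
theorem rotConfig_rotConfig (a b : ℕ) (ω : SiteConfig (Site 2)) : rotConfig a (rotConfig b ω) = rotConfig (a + b) ω := by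
  ext v; rw [mem_rotConfig_add, mem_rotConfig]

/-- **Two disjoint open arms from `∂Λ_n` landed on the CONSECUTIVE sides `0` and `1` of `∂Λ_N`**,
read through rotations (the shape of `sepArmDuo 0 true` of `SepFourAdj.lean` at the outer end):
disjoint confining sets `X`, `Y` with `ω ∩ X` landed on the right side and `rotConfig 1 (ω ∩ Y)`
landed on the right side. [cite: Nolin2008, §4.2 Def. 6–8 and §4.4 (arXiv 0711.4948: Def. 6–8; proof of Thm. 10, p. 13), σ = BBWW] -/
def extOpenDuoR (n N : ℕ) : Set (SiteConfig (Site 2)) :=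
  {ω | ∃ X Y : Set (Site 2), Disjoint X Y ∧ ω ∩ X ∈ extOpenArm n N ∧ rotConfig 1 (ω ∩ Y) ∈ extOpenArm n N}

/-- The pair event on consecutive sides is increasing. [folklore] -/
theorem isUpperSet_extOpenDuoR (n N : ℕ) : IsUpperSet (extOpenDuoR n N) := by
  rintro ω ω' hle ⟨X, Y, hXY, hX, hY⟩
  exact ⟨X, Y, hXY, isUpperSet_extOpenArm n N (Set.inter_subset_inter_left X hle) hX,
    isUpperSet_extOpenArm n N (rotConfig_mono 1 (Set.inter_subset_inter_left Y hle)) hY⟩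

/-- **Two exits (general form) of one colour with disjoint regions land on the consecutive sides `0, 1` of
`∂Λ_{4M}`** (both moves are `extOpenArm_inter_rowRegion`, the second in the configuration
`rotConfig 1 ω` with its exit read through `ρ^{a₁}` of it, i.e. through `ρ^{a₁+1}` of `ω`). [cite: Nolin2008, §4.2 Def. 6–8, §4.3 Prop. 12 and §4.4 (arXiv 0711.4948: Def. 6–8, Prop. 11; proof of Thm. 10, p. 13), σ = BBWW] -/
theorem extOpenDuoR_of_exits' {M n k₀ K R₀ : ℕ} (hnM : n ≤ M) (hM : 64 ≤ M) {ω : SiteConfig (Site 2)}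
    -- the exit landing on the side `0`
    {i₀ : ℕ} (hi₀ : i₀ < 6) (F₀ : TrapExit M n k₀ K (rotConfig i₀ ω)) {S₀ : Set (Site 2)} (hP₀ : PathIn triGraph S₀ F₀.a F₀.m)
    (hS₀ : S₀ ⊆ (triAnnSet n (2 * M) ∪ trapExitZone M F₀.z F₀.k) ∩ rotConfig i₀ ω)
    (hmid₀ : -(2 * (M : ℤ)) + R₀ ≤ F₀.z 1 ∧ F₀.z 1 ≤ -(R₀ : ℤ)) (hRk₀ : 4 * F₀.k + 2 ≤ R₀) (hkM₀ : 2 * (F₀.k : ℤ) + 1 ≤ M)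
    {T₀ : ℤ} {w₀ : ℕ} (hwin₀ : T₀ ≤ F₀.z 1 ∧ F₀.z 1 < T₀ + w₀) (hT₀ : -(2 * (M : ℤ)) ≤ T₀)
    {L₀ ε₀ : ℕ} (hfit₀ : (w₀ : ℤ) + (F₀.k / 4 : ℕ) + 2 * ε₀ ≤ F₀.k) (hL₀ : F₀.k + 1 ≤ L₀) (hSp₀ : ω ∈ extSpokeEvent i₀ M F₀.k T₀ w₀ L₀ ε₀)
    {r₀ e₀ s₀ a₀ len₀ : ℕ} (hs₀ : 1 ≤ s₀) (hsr₀ : s₀ ∣ r₀) (hsr₀' : s₀ ≤ r₀) (he₀ : 2 * e₀ ≤ r₀)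
    (harc₀ : ω ∈ eventAll (arc (thinRing r₀ e₀ s₀) a₀ len₀))
    {Te₀ : Tube} (hTe₀ : Te₀ ∈ arc (thinRing r₀ e₀ s₀) a₀ len₀) (hJ₀ : SpokeMeetsRot i₀ (extSpokeTube M F₀.k T₀ w₀ L₀ ε₀) Te₀)
    {t₀ : ℤ} (ht₀ : -(2 * (M : ℤ)) + (4 * M / 16 : ℕ) ≤ t₀ ∧ t₀ ≤ -(M : ℤ) - (4 * M / 16 : ℕ))
    {j₀ d₀ : ℕ} (hSL₀ : ∀ T ∈ vchunks r₀ (-(r₀ : ℤ)) e₀ s₀ j₀ (d₀ + 1), T ∈ arc (thinRing r₀ e₀ s₀) a₀ len₀)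
    (hlo₀ : -(r₀ : ℤ) + j₀ * s₀ - e₀ ≤ t₀) (hhi₀ : t₀ + (4 * M / 64 : ℕ) ≤ -(r₀ : ℤ) + (j₀ + d₀) * s₀ - e₀)
    {W₀ : ℕ} (hW₀ : (r₀ : ℤ) - 2 * e₀ + W₀ = 4 * M + (4 * M / 16 : ℕ))
    (hH₀ : ω ∈ triHCross ((r₀ : ℤ) - 2 * e₀) t₀ W₀ (4 * M / 64)) (hV₀ : ω ∈ otgtV (4 * M) t₀)
    (hkL₀ : (F₀.k : ℤ) + L₀ ≤ 2 * M) (hr2₀ : 2 * (M : ℤ) < (r₀ : ℤ) - s₀ - 2 * e₀) (hr4₀ : (r₀ : ℤ) + 2 * e₀ ≤ 4 * M)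
    -- the exit landing on the side `1`: everything in the configuration `rotConfig 1 ω`
    {a₁ : ℕ} (ha₁ : a₁ < 6) (F₁ : TrapExit M n k₀ K (rotConfig a₁ (rotConfig 1 ω))) {S₁ : Set (Site 2)}
    (hP₁ : PathIn triGraph S₁ F₁.a F₁.m) (hS₁ : S₁ ⊆ (triAnnSet n (2 * M) ∪ trapExitZone M F₁.z F₁.k) ∩ rotConfig a₁ (rotConfig 1 ω))
    (hmid₁ : -(2 * (M : ℤ)) + R₀ ≤ F₁.z 1 ∧ F₁.z 1 ≤ -(R₀ : ℤ)) (hRk₁ : 4 * F₁.k + 2 ≤ R₀) (hkM₁ : 2 * (F₁.k : ℤ) + 1 ≤ M)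
    {T₁ : ℤ} {w₁ : ℕ} (hwin₁ : T₁ ≤ F₁.z 1 ∧ F₁.z 1 < T₁ + w₁) (hT₁ : -(2 * (M : ℤ)) ≤ T₁)
    {L₁ ε₁ : ℕ} (hfit₁ : (w₁ : ℤ) + (F₁.k / 4 : ℕ) + 2 * ε₁ ≤ F₁.k) (hL₁ : F₁.k + 1 ≤ L₁)
    (hSp₁ : rotConfig 1 ω ∈ extSpokeEvent a₁ M F₁.k T₁ w₁ L₁ ε₁)
    {r₁ e₁ s₁ a₁' len₁ : ℕ} (hs₁ : 1 ≤ s₁) (hsr₁ : s₁ ∣ r₁) (hsr₁' : s₁ ≤ r₁) (he₁ : 2 * e₁ ≤ r₁)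
    (harc₁ : rotConfig 1 ω ∈ eventAll (arc (thinRing r₁ e₁ s₁) a₁' len₁))
    {Te₁ : Tube} (hTe₁ : Te₁ ∈ arc (thinRing r₁ e₁ s₁) a₁' len₁) (hJ₁ : SpokeMeetsRot a₁ (extSpokeTube M F₁.k T₁ w₁ L₁ ε₁) Te₁)
    {t₁ : ℤ} (ht₁ : -(2 * (M : ℤ)) + (4 * M / 16 : ℕ) ≤ t₁ ∧ t₁ ≤ -(M : ℤ) - (4 * M / 16 : ℕ))
    {j₁ d₁ : ℕ} (hSL₁ : ∀ T ∈ vchunks r₁ (-(r₁ : ℤ)) e₁ s₁ j₁ (d₁ + 1), T ∈ arc (thinRing r₁ e₁ s₁) a₁' len₁)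
    (hlo₁ : -(r₁ : ℤ) + j₁ * s₁ - e₁ ≤ t₁) (hhi₁ : t₁ + (4 * M / 64 : ℕ) ≤ -(r₁ : ℤ) + (j₁ + d₁) * s₁ - e₁)
    {W₁ : ℕ} (hW₁ : (r₁ : ℤ) - 2 * e₁ + W₁ = 4 * M + (4 * M / 16 : ℕ))
    (hH₁ : rotConfig 1 ω ∈ triHCross ((r₁ : ℤ) - 2 * e₁) t₁ W₁ (4 * M / 64)) (hV₁ : rotConfig 1 ω ∈ otgtV (4 * M) t₁)
    (hkL₁ : (F₁.k : ℤ) + L₁ ≤ 2 * M) (hr2₁ : 2 * (M : ℤ) < (r₁ : ℤ) - s₁ - 2 * e₁) (hr4₁ : (r₁ : ℤ) + 2 * e₁ ≤ 4 * M)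
    -- the two regions are disjoint (the second read back in the original frame)
    (hdisj : Disjoint (rowRegion i₀ M S₀ F₀.z F₀.k T₀ w₀ L₀ ε₀ r₀ e₀ s₀ a₀ len₀ t₀ W₀)
      (triRotIsoPow 1 '' rowRegion a₁ M S₁ F₁.z F₁.k T₁ w₁ L₁ ε₁ r₁ e₁ s₁ a₁' len₁ t₁ W₁)) :
    ω ∈ extOpenDuoR n (4 * M) := by
  refine ⟨_, _, hdisj,
    extOpenArm_inter_rowRegion' hnM hi₀ F₀ hP₀ hS₀ hmid₀ hRk₀ hkM₀ hwin₀ hT₀ hfit₀ hL₀ hSp₀ hs₀ hsr₀ hsr₀' he₀ harc₀ hTe₀ hJ₀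
      ht₀ hSL₀ hlo₀ hhi₀ hW₀ hH₀ hV₀ hM hkL₀ hr2₀ hr4₀, ?_⟩
  rw [rotConfig_inter_image]
  exact extOpenArm_inter_rowRegion' hnM ha₁ F₁ hP₁ hS₁ hmid₁ hRk₁ hkM₁ hwin₁ hT₁ hfit₁ hL₁ hSp₁ hs₁ hsr₁ hsr₁' he₁ harc₁ hTe₁ hJ₁
    ht₁ hSL₁ hlo₁ hhi₁ hW₁ hH₁ hV₁ hM hkL₁ hr2₁ hr4₁

/-- **Two fenced exits of one colour with disjoint regions land on the consecutive sides `0, 1` of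
`∂Λ_{4M}`** (both moves are `extOpenArm_inter_rowRegion`, the second in the configuration
`rotConfig 1 ω` with its exit read through `ρ^{a₁}` of it, i.e. through `ρ^{a₁+1}` of `ω`). [cite: Nolin2008, §4.2 Def. 6–8, §4.3 Prop. 12 and §4.4 (arXiv 0711.4948: Def. 6–8, Prop. 11; proof of Thm. 10, p. 13), σ = BBWW] -/
theorem extOpenDuoR_of_exits {M n k₀ K R₀ : ℕ} (hnM : n ≤ M) (hM : 64 ≤ M) {ω : SiteConfig (Site 2)}
    -- the exit landing on the side `0`
    {i₀ : ℕ} (hi₀ : i₀ < 6) (F₀ : TrapFencedExit M n k₀ K (rotConfig i₀ ω)) {S₀ : Set (Site 2)} (hP₀ : PathIn triGraph S₀ F₀.a F₀.m)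
    (hS₀ : S₀ ⊆ (triAnnSet n (2 * M) ∪ trapFrameZone M F₀.z F₀.k) ∩ rotConfig i₀ ω)
    (hmid₀ : -(2 * (M : ℤ)) + R₀ ≤ F₀.z 1 ∧ F₀.z 1 ≤ -(R₀ : ℤ)) (hRk₀ : 4 * F₀.k + 2 ≤ R₀) (hkM₀ : 2 * (F₀.k : ℤ) + 1 ≤ M)
    {T₀ : ℤ} {w₀ : ℕ} (hwin₀ : T₀ ≤ F₀.z 1 ∧ F₀.z 1 < T₀ + w₀) (hT₀ : -(2 * (M : ℤ)) ≤ T₀)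
    {L₀ ε₀ : ℕ} (hfit₀ : (w₀ : ℤ) + (F₀.k / 4 : ℕ) + 2 * ε₀ ≤ F₀.k) (hL₀ : F₀.k + 1 ≤ L₀) (hSp₀ : ω ∈ extSpokeEvent i₀ M F₀.k T₀ w₀ L₀ ε₀)
    {r₀ e₀ s₀ a₀ len₀ : ℕ} (hs₀ : 1 ≤ s₀) (hsr₀ : s₀ ∣ r₀) (hsr₀' : s₀ ≤ r₀) (he₀ : 2 * e₀ ≤ r₀)
    (harc₀ : ω ∈ eventAll (arc (thinRing r₀ e₀ s₀) a₀ len₀))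
    {Te₀ : Tube} (hTe₀ : Te₀ ∈ arc (thinRing r₀ e₀ s₀) a₀ len₀) (hJ₀ : SpokeMeetsRot i₀ (extSpokeTube M F₀.k T₀ w₀ L₀ ε₀) Te₀)
    {t₀ : ℤ} (ht₀ : -(2 * (M : ℤ)) + (4 * M / 16 : ℕ) ≤ t₀ ∧ t₀ ≤ -(M : ℤ) - (4 * M / 16 : ℕ))
    {j₀ d₀ : ℕ} (hSL₀ : ∀ T ∈ vchunks r₀ (-(r₀ : ℤ)) e₀ s₀ j₀ (d₀ + 1), T ∈ arc (thinRing r₀ e₀ s₀) a₀ len₀)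
    (hlo₀ : -(r₀ : ℤ) + j₀ * s₀ - e₀ ≤ t₀) (hhi₀ : t₀ + (4 * M / 64 : ℕ) ≤ -(r₀ : ℤ) + (j₀ + d₀) * s₀ - e₀)
    {W₀ : ℕ} (hW₀ : (r₀ : ℤ) - 2 * e₀ + W₀ = 4 * M + (4 * M / 16 : ℕ))
    (hH₀ : ω ∈ triHCross ((r₀ : ℤ) - 2 * e₀) t₀ W₀ (4 * M / 64)) (hV₀ : ω ∈ otgtV (4 * M) t₀)
    (hkL₀ : (F₀.k : ℤ) + L₀ ≤ 2 * M) (hr2₀ : 2 * (M : ℤ) < (r₀ : ℤ) - s₀ - 2 * e₀) (hr4₀ : (r₀ : ℤ) + 2 * e₀ ≤ 4 * M)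
    -- the exit landing on the side `1`: everything in the configuration `rotConfig 1 ω`
    {a₁ : ℕ} (ha₁ : a₁ < 6) (F₁ : TrapFencedExit M n k₀ K (rotConfig a₁ (rotConfig 1 ω))) {S₁ : Set (Site 2)}
    (hP₁ : PathIn triGraph S₁ F₁.a F₁.m) (hS₁ : S₁ ⊆ (triAnnSet n (2 * M) ∪ trapFrameZone M F₁.z F₁.k) ∩ rotConfig a₁ (rotConfig 1 ω))
    (hmid₁ : -(2 * (M : ℤ)) + R₀ ≤ F₁.z 1 ∧ F₁.z 1 ≤ -(R₀ : ℤ)) (hRk₁ : 4 * F₁.k + 2 ≤ R₀) (hkM₁ : 2 * (F₁.k : ℤ) + 1 ≤ M)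
    {T₁ : ℤ} {w₁ : ℕ} (hwin₁ : T₁ ≤ F₁.z 1 ∧ F₁.z 1 < T₁ + w₁) (hT₁ : -(2 * (M : ℤ)) ≤ T₁)
    {L₁ ε₁ : ℕ} (hfit₁ : (w₁ : ℤ) + (F₁.k / 4 : ℕ) + 2 * ε₁ ≤ F₁.k) (hL₁ : F₁.k + 1 ≤ L₁)
    (hSp₁ : rotConfig 1 ω ∈ extSpokeEvent a₁ M F₁.k T₁ w₁ L₁ ε₁)
    {r₁ e₁ s₁ a₁' len₁ : ℕ} (hs₁ : 1 ≤ s₁) (hsr₁ : s₁ ∣ r₁) (hsr₁' : s₁ ≤ r₁) (he₁ : 2 * e₁ ≤ r₁)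
    (harc₁ : rotConfig 1 ω ∈ eventAll (arc (thinRing r₁ e₁ s₁) a₁' len₁))
    {Te₁ : Tube} (hTe₁ : Te₁ ∈ arc (thinRing r₁ e₁ s₁) a₁' len₁) (hJ₁ : SpokeMeetsRot a₁ (extSpokeTube M F₁.k T₁ w₁ L₁ ε₁) Te₁)
    {t₁ : ℤ} (ht₁ : -(2 * (M : ℤ)) + (4 * M / 16 : ℕ) ≤ t₁ ∧ t₁ ≤ -(M : ℤ) - (4 * M / 16 : ℕ))
    {j₁ d₁ : ℕ} (hSL₁ : ∀ T ∈ vchunks r₁ (-(r₁ : ℤ)) e₁ s₁ j₁ (d₁ + 1), T ∈ arc (thinRing r₁ e₁ s₁) a₁' len₁)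
    (hlo₁ : -(r₁ : ℤ) + j₁ * s₁ - e₁ ≤ t₁) (hhi₁ : t₁ + (4 * M / 64 : ℕ) ≤ -(r₁ : ℤ) + (j₁ + d₁) * s₁ - e₁)
    {W₁ : ℕ} (hW₁ : (r₁ : ℤ) - 2 * e₁ + W₁ = 4 * M + (4 * M / 16 : ℕ))
    (hH₁ : rotConfig 1 ω ∈ triHCross ((r₁ : ℤ) - 2 * e₁) t₁ W₁ (4 * M / 64)) (hV₁ : rotConfig 1 ω ∈ otgtV (4 * M) t₁)
    (hkL₁ : (F₁.k : ℤ) + L₁ ≤ 2 * M) (hr2₁ : 2 * (M : ℤ) < (r₁ : ℤ) - s₁ - 2 * e₁) (hr4₁ : (r₁ : ℤ) + 2 * e₁ ≤ 4 * M)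
    -- the two regions are disjoint (the second read back in the original frame)
    (hdisj : Disjoint (rowRegion i₀ M S₀ F₀.z F₀.k T₀ w₀ L₀ ε₀ r₀ e₀ s₀ a₀ len₀ t₀ W₀)
      (triRotIsoPow 1 '' rowRegion a₁ M S₁ F₁.z F₁.k T₁ w₁ L₁ ε₁ r₁ e₁ s₁ a₁' len₁ t₁ W₁)) :
    ω ∈ extOpenDuoR n (4 * M) :=
  extOpenDuoR_of_exits' hnM hM hi₀ F₀.toTrapExit hP₀ (hS₀.trans exitRegion_mono) hmid₀ hRk₀ hkM₀ hwin₀ hT₀ hfit₀ hL₀ hSp₀ hs₀ hsr₀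
    hsr₀' he₀ harc₀ hTe₀ hJ₀ ht₀ hSL₀ hlo₀ hhi₀ hW₀ hH₀ hV₀ hkL₀ hr2₀ hr4₀ ha₁ F₁.toTrapExit hP₁ (hS₁.trans exitRegion_mono) hmid₁
    hRk₁ hkM₁ hwin₁ hT₁ hfit₁ hL₁ hSp₁ hs₁ hsr₁ hsr₁' he₁ harc₁ hTe₁ hJ₁ ht₁ hSL₁ hlo₁ hhi₁ hW₁ hH₁ hV₁ hkL₁ hr2₁ hr4₁ hdisj

end Literature.Probability.Percolation
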